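import Summits.QuantumFields.YangMills.Theorems.UnitScaleTiltProp7CurvedLandauCoreT3
import Summits.QuantumFields.YangMills.Theorems.UnitScaleTiltProp7FibreTrueLinDefectMass
import HarnessLib

/-!
# Route `UnitScaleTilt`, crux K1 «MinimiserStabilityRegPr» (stmt-QuantumFields-19200), route-R [RP] curved — THE CURVED LINEAR CORE ON THE NONLINEAR (0.4)-FIBRE:
# ✓ `…CurvedLandauCoreT3` at `Y := WU₀* − 1` for a competitor `W` with `W̄^{(K−n)} = Ū₀^{(K−n)}`, with the true-average constraint budget `Z_Q` DISCHARGED by the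
# `Q`-junction (✓ `…FibreTrueLinDefectMass`): `Z_Q := (E_k·S_k + 2√d·Σ_{j<k}C_CM·E_j·S_j)²`, `S_j = 260(d+2)L√((2dL^d)(2d))·Σ_{i<j}ρ^{j−1−i}μ_i‖Y_i‖_{ℓ²}`

Cell `ym3-torus`, keyed width hand `ym-routeR-w3` (D-0154 (3c)); sequel of ✓ p620132 `…CurvedLandauCoreT3` and ✓ p619838 `…FibreTrueLinDefectMass`.  THEOREMS ONLY (0 `def`,
0 `sorry`); `--supports stmt-QuantumFields-19200`, count-neutral.  YM₃ on T³ is a ladder rung (R3), not the Clay problem; nothing here claims the stub, the crux, d = 4 or the gap.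

THE POINT.  The S3 «nonlinear passage» of stub P compares the minimiser `U₀` with a competitor `W` on the SAME (0.4)-fibre; `Y := WU₀* − 1 = pertVar U₀ W`.  The curved linear core
(S2′ with `hA`∕`hE` discharged, `hΛ` in ★routeR-w2's curl letters) carries the budget `Σ_c‖Q^{(K−n)}Y(c)‖² ≤ Z_Q` for the TRUE linearised constraint value; on the fibre the
`Q`-junction bounds `√(Σ_c‖Q^{(K−n)}Y(c)‖²)` by per-level SUP × MASS data of the level ratios `Y_j = pertVar Ū₀^{(j)}W̄^{(j)}`.  This file plugs the one into the other: the tower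
sizes of the junction (`a_j = ((d+2)L)²∕2·2ε·L^{2j}∕L^{2(K−n)}`, `a′ = 4ε`) are DISCHARGED from the (14)-type plaquette bound by ✓ `Prop7CurvedLandauRowE.loop_size_geom` ∕
`size_numerals` and ★routeR-w2's `tower_plaq_lt` (tower run at `2ε`, numerals from `2·10¹³L⁹ε ≤ 1` via ✓ `smallness_T3`).  DISPLAYED (honest, named suppliers): the divergence budget
`(δ, Z)` (★routeR-w3 g0's point-Landau rows ∕ the pinned–Landau fork), ★routeR-w2's curl-lettered `(H¹)^*` row `hΛcurl`, and the per-level sup × mass inputs `μ_j`, `‖Y_j‖_{ℓ²}`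
(two-field∕cut-off sups; `C_reg` interior input).

WHAT IS PROVED (ns `…Theorems.Prop7CurvedLandauCoreFibreT3`): ★★★ `sum_normSq_le_curl_sq_core_of_fibre_T3`.
HONEST SCOPE.  A junction by `exact`∕squaring over the two landed theorems; nothing of print is asserted beyond the cited tree theorems.

References: T. Bałaban, CMP 99 (1985) 389–434 [Balaban1985BackgroundPropagators] (Thm 3.11 p.416); CMP 102 (1985) 277–309 [Balaban1985Variational] ((14)–(15) p.280, Prop. 7 p.299);
CMP 98 (1985) 17–51 [Balaban1985Averaging] (Prop. 3 (122)–(126) p.36).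
-/

set_option autoImplicit false

noncomputable section

open scoped BigOperators Matrix.Norms.L2Operator Matrix

namespace Summit.QuantumFields.YangMills.Theorems.Prop7CurvedLandauCoreFibreT3

open Literature.MathematicalPhysics.QuantumFieldTheory.Balaban1983to89
open Literature.MathematicalPhysics.QuantumFieldTheory.Balaban1983to89.T3ContinuumYM3Torus
open Finset T4Continuum T4ReflectionCone BlockAveraging AveragingRT ExpMeanLog BlockAveragingEMLLinearised BlockAveragingEMLLinearisedBackground
  BlockAveragingEMLProp2 B1RG242Torus
open B15DeterminingSets (embIter)
open B7Prop1Explicit (treeWord)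
open B7Eq78Linearization (conjR)
open B9Eq39Adjoint (curl divB)
open B10Eq27TorusAxialLog (holT unitsField toUField)
open B9TorusCalculus (torusT)
open Summit.QuantumFields.YangMills.Theorems.Prop7CurvedLandauCoreT3 (sum_normSq_le_curl_sq_core_of_hLambdaCurl_T3)
open Summit.QuantumFields.YangMills.Theorems.Prop7CurvedLandauKnitT3 (smallness_T3 three_le_L)
open Summit.QuantumFields.YangMills.Theorems.Prop7CurvedLandauRowE (loop_size_geom size_numerals)
open Summit.QuantumFields.YangMills.Theorems.Prop7CovIterLambdaBound (tower_plaq_lt plaqSmall_of_le_of_lt)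
open Summit.QuantumFields.YangMills.Theorems.Prop7FibreTrueLinDefectMass (sqrt_sum_normSq_trueLinIter_le_of_iter_eq_mass)

/-- ★★★ **THE CURVED LINEAR CORE ON THE NONLINEAR (0.4)-FIBRE (d = 3, `SU(2)`).**  `U₀`, `W` on the finest torus of run `K` with `W̄^{(K−n)} = Ū₀^{(K−n)}`; background
plaquettes `dist1(U₀(∂p)) ≤ ε·L^{−2(K−n)}`, `0 < ε`, `2·10¹³·L⁹·ε ≤ 1`; `Y := pertVar U₀ W`; the recursion families of record `Q, G, S, Λ` at `U₀` for this `Y` (displayed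
recursions); the divergence budget `Σ‖D^*_{U₀}Y‖²_HS ≤ δΣ‖Y‖² + Z`; ★routeR-w2's curl-lettered row `hΛcurl`; and per-level bounds `μ_j` of the two-block masses
`(d+2)L·Σ_{b∈N(c)}‖Y_j(b)‖` of the level ratios (`0 ≤ μ_j`, `72μ_j ≤ 1`, `3μ_j + 1∕24 < δ₂`).  THEN
`((1∕2)ℓ⁻² − (18 + 76800L⁴)δ)·Σ‖Y‖² − (18 + 76800L⁴)·Z − 96ℓ⁻¹·Z_Q ≤ (18 + 76800L⁴)·Σ‖D_{U₀}Y‖²_HS` with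
`Z_Q := (E_k·S_k + 2√d·Σ_{j<k}C_CM·(E_j·S_j))²` EXPLICIT in the sup × mass data (letters of ✓ `…FibreTrueLinDefectMass` at `a_j = ((d+2)L)²ε·L^{2j}∕L^{2k}`, `a′ = 4ε`).
[cite: Balaban1985BackgroundPropagators, Thm 3.11 p.416; Balaban1985Variational, (14)-(15) p.280, Prop. 7 p.299; Balaban1985Averaging, Prop. 3 (122)-(126) p.36] -/
theorem sum_normSq_le_curl_sq_core_of_fibre_T3 (F : T3Family) (n K : ℕ)
    (U₀ W : GaugeField (F.P K) 0 (Matrix.specialUnitaryGroup (Fin 2) ℂ)) {ε : ℝ} (hε : 0 < ε) (hεL : 20000000000000 * (F.L : ℝ) ^ 9 * ε ≤ 1)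
    (hU : ∀ p : Plaq (F.P K) 0, dist1 (GaugeField.plaqHol U₀ p) ≤ ε * (((F.L : ℝ) ^ (K - n)) ^ 2)⁻¹)
    (hfib : Averaging.iter (fun i => blockAvg (P := F.P K) (j := i) (expMeanLogSU (n := Fin 2))) (K - n) W = Averaging.iter (fun i => blockAvg (P := F.P K) (j := i) (expMeanLogSU (n := Fin 2))) (K - n) U₀)
    (Q : (k : ℕ) → (PBond (F.P K) 0 → Matrix (Fin 2) (Fin 2) ℂ) → PBond (F.P K) k → Matrix (Fin 2) (Fin 2) ℂ) (hQ0 : ∀ Y, Q 0 Y = Y)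
    (hQs : ∀ (k : ℕ) (Y : PBond (F.P K) 0 → Matrix (Fin 2) (Fin 2) ℂ) (c : PBond (F.P K) (k + 1)), Q (k + 1) Y c
      = fderiv ℂ (eml : (Idx (F.P K) → Matrix (Fin 2) (Fin 2) ℂ) → Matrix (Fin 2) (Fin 2) ℂ)
            (fun i => ((loopHol (Averaging.iter (fun i => blockAvg (P := F.P K) (j := i) (expMeanLogSU (n := Fin 2))) k U₀) c i :
              Matrix.specialUnitaryGroup (Fin 2) ℂ) : Matrix (Fin 2) (Fin 2) ℂ))
            (fun i => covWalkSum (Averaging.iter (fun i => blockAvg (P := F.P K) (j := i) (expMeanLogSU (n := Fin 2))) k U₀) (Q k Y)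
                (walk (emb c.src) (loopWord (F.P K).L c.dir (off i.1) i.2.1 i.2.2))
              * ((loopHol (Averaging.iter (fun i => blockAvg (P := F.P K) (j := i) (expMeanLogSU (n := Fin 2))) k U₀) c i :
                Matrix.specialUnitaryGroup (Fin 2) ℂ) : Matrix (Fin 2) (Fin 2) ℂ))
            * star ((corr (expMeanLogSU (n := Fin 2)) (Averaging.iter (fun i => blockAvg (P := F.P K) (j := i) (expMeanLogSU (n := Fin 2))) k U₀) c :
                Matrix.specialUnitaryGroup (Fin 2) ℂ) : Matrix (Fin 2) (Fin 2) ℂ)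
          + ((corr (expMeanLogSU (n := Fin 2)) (Averaging.iter (fun i => blockAvg (P := F.P K) (j := i) (expMeanLogSU (n := Fin 2))) k U₀) c :
                Matrix.specialUnitaryGroup (Fin 2) ℂ) : Matrix (Fin 2) (Fin 2) ℂ)
            * covWalkSum (Averaging.iter (fun i => blockAvg (P := F.P K) (j := i) (expMeanLogSU (n := Fin 2))) k U₀) (Q k Y)
                (walk (emb c.src) (List.replicate (F.P K).L (c.dir, true)))
            * star ((corr (expMeanLogSU (n := Fin 2)) (Averaging.iter (fun i => blockAvg (P := F.P K) (j := i) (expMeanLogSU (n := Fin 2))) k U₀) c :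
                Matrix.specialUnitaryGroup (Fin 2) ℂ) : Matrix (Fin 2) (Fin 2) ℂ))
    (G S : (k : ℕ) → PBond (F.P K) k → Matrix (Fin 2) (Fin 2) ℂ) (Λ : (k : ℕ) → Site (F.P K) k → Matrix (Fin 2) (Fin 2) ℂ)
    (hG0 : ∀ b, G 0 b = pertVar U₀ W b) (hS0 : ∀ b, S 0 b = pertVar U₀ W b) (hΛ0 : ∀ x, Λ 0 x = 0)
    (hΛs : ∀ (k : ℕ) (z : Site (F.P K) (k + 1)), Λ (k + 1) z
      = ((Fintype.card (Idx (F.P K)) : ℂ))⁻¹ • ∑ i : Idx (F.P K),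
          covWalkSum (Averaging.iter (fun i => blockAvg (P := F.P K) (j := i) (expMeanLogSU (n := Fin 2))) k U₀) (G k)
            (walk (emb z) (stairWord i.2.1 (off i.1)))
        + Λ k (emb z))
    (hGs : ∀ (k : ℕ) (c : PBond (F.P K) (k + 1)), G (k + 1) c
      = (fderiv ℂ (eml : (Idx (F.P K) → Matrix (Fin 2) (Fin 2) ℂ) → Matrix (Fin 2) (Fin 2) ℂ)
            (fun i => ((loopHol (Averaging.iter (fun i => blockAvg (P := F.P K) (j := i) (expMeanLogSU (n := Fin 2))) k U₀) c i :
              Matrix.specialUnitaryGroup (Fin 2) ℂ) : Matrix (Fin 2) (Fin 2) ℂ))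
            (fun i => covWalkSum (Averaging.iter (fun i => blockAvg (P := F.P K) (j := i) (expMeanLogSU (n := Fin 2))) k U₀) (G k)
                (walk (emb c.src) (loopWord (F.P K).L c.dir (off i.1) i.2.1 i.2.2))
              * ((loopHol (Averaging.iter (fun i => blockAvg (P := F.P K) (j := i) (expMeanLogSU (n := Fin 2))) k U₀) c i :
                Matrix.specialUnitaryGroup (Fin 2) ℂ) : Matrix (Fin 2) (Fin 2) ℂ))
            * star ((corr (expMeanLogSU (n := Fin 2)) (Averaging.iter (fun i => blockAvg (P := F.P K) (j := i) (expMeanLogSU (n := Fin 2))) k U₀) c :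
                Matrix.specialUnitaryGroup (Fin 2) ℂ) : Matrix (Fin 2) (Fin 2) ℂ)
          + ((corr (expMeanLogSU (n := Fin 2)) (Averaging.iter (fun i => blockAvg (P := F.P K) (j := i) (expMeanLogSU (n := Fin 2))) k U₀) c :
                Matrix.specialUnitaryGroup (Fin 2) ℂ) : Matrix (Fin 2) (Fin 2) ℂ)
            * covWalkSum (Averaging.iter (fun i => blockAvg (P := F.P K) (j := i) (expMeanLogSU (n := Fin 2))) k U₀) (G k)
                (walk (emb c.src) (List.replicate (F.P K).L (c.dir, true)))
            * star ((corr (expMeanLogSU (n := Fin 2)) (Averaging.iter (fun i => blockAvg (P := F.P K) (j := i) (expMeanLogSU (n := Fin 2))) k U₀) c :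
                Matrix.specialUnitaryGroup (Fin 2) ℂ) : Matrix (Fin 2) (Fin 2) ℂ))
        - ((((Fintype.card (Idx (F.P K)) : ℂ))⁻¹ • ∑ i : Idx (F.P K),
              covWalkSum (Averaging.iter (fun i => blockAvg (P := F.P K) (j := i) (expMeanLogSU (n := Fin 2))) k U₀) (G k) (walk (emb c.src) (stairWord i.2.1 (off i.1))))
            - ((Averaging.iter (fun i => blockAvg (P := F.P K) (j := i) (expMeanLogSU (n := Fin 2))) (k + 1) U₀ c : Matrix.specialUnitaryGroup (Fin 2) ℂ) :
                Matrix (Fin 2) (Fin 2) ℂ)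
              * (((Fintype.card (Idx (F.P K)) : ℂ))⁻¹ • ∑ i : Idx (F.P K),
                  covWalkSum (Averaging.iter (fun i => blockAvg (P := F.P K) (j := i) (expMeanLogSU (n := Fin 2))) k U₀) (G k) (walk (emb c.tgt) (stairWord i.2.1 (off i.1))))
              * star ((Averaging.iter (fun i => blockAvg (P := F.P K) (j := i) (expMeanLogSU (n := Fin 2))) (k + 1) U₀ c :
                Matrix.specialUnitaryGroup (Fin 2) ℂ) : Matrix (Fin 2) (Fin 2) ℂ)))
    (hSs : ∀ (k : ℕ) (c : PBond (F.P K) (k + 1)), S (k + 1) c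
      = ((Fintype.card (Idx (F.P K)) : ℂ))⁻¹ • ∑ i : Idx (F.P K),
          ((holAt (Averaging.iter (fun i => blockAvg (P := F.P K) (j := i) (expMeanLogSU (n := Fin 2))) k U₀) (walk (emb c.src) (stairWord i.2.1 (off i.1))) :
              Matrix.specialUnitaryGroup (Fin 2) ℂ) : Matrix (Fin 2) (Fin 2) ℂ) *
            covWalkSum (Averaging.iter (fun i => blockAvg (P := F.P K) (j := i) (expMeanLogSU (n := Fin 2))) k U₀) (S k)
              (walk (walkEnd (emb c.src) (stairWord i.2.1 (off i.1))) (List.replicate (F.P K).L (c.dir, true))) *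
          star ((holAt (Averaging.iter (fun i => blockAvg (P := F.P K) (j := i) (expMeanLogSU (n := Fin 2))) k U₀) (walk (emb c.src) (stairWord i.2.1 (off i.1))) :
              Matrix.specialUnitaryGroup (Fin 2) ℂ) : Matrix (Fin 2) (Fin 2) ℂ))
    {δ Z : ℝ}
    (hdivB : (∑ x : Site (F.P K) 0, ∑ j : Fin 2, ∑ k : Fin 2,
            ‖(divB (torusT (F.P K) 0) (fun κ z => unitsField (toUField U₀) ⟨z, κ⟩) (fun κ z => pertVar U₀ W ⟨z, κ⟩) x) j k‖ ^ 2)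
      ≤ δ * (∑ b : PBond (F.P K) 0, ‖pertVar U₀ W b‖ ^ 2) + Z)
    (hΛcurl : ∑ y : Site (F.P K) (K - n), ‖Λ (K - n) y‖ ^ 2
      ≤ ((F.L : ℝ) ^ (K - n)) * (100 * (2 : ℝ) * (F.L : ℝ) ^ 4 * ((∑ x : Site (F.P K) 0, ∑ μ : Fin (F.P K).d, ∑ ν : Fin (F.P K).d,
            (if μ < ν then ∑ j : Fin 2, ∑ k : Fin 2,
              ‖(curl (torusT (F.P K) 0) (fun κ z => unitsField (toUField U₀) ⟨z, κ⟩) (fun κ z => pertVar U₀ W ⟨z, κ⟩) μ ν x) j k‖ ^ 2 else 0))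
          + (∑ x : Site (F.P K) 0, ∑ j : Fin 2, ∑ k : Fin 2,
            ‖(divB (torusT (F.P K) 0) (fun κ z => unitsField (toUField U₀) ⟨z, κ⟩) (fun κ z => pertVar U₀ W ⟨z, κ⟩) x) j k‖ ^ 2))
        + 1000000000 * (2 : ℝ) ^ 2 * (F.L : ℝ) ^ 9 * ε * (((F.L : ℝ) ^ (K - n)) ^ 2)⁻¹ * (∑ b : PBond (F.P K) 0, ‖pertVar U₀ W b‖ ^ 2)))
    (μ : ℕ → ℝ) (hμ0 : ∀ j < K - n, 0 ≤ μ j)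
    (hμ : ∀ j < K - n, ∀ c : PBond (F.P K) (j + 1), ((((F.P K).d + 2) * (F.P K).L : ℕ) : ℝ) * ∑ b ∈ (univ.filter (fun b : PBond (F.P K) j => blockOf b.src = c.src ∨ blockOf b.src = c.tgt)), ‖(pertVar (Averaging.iter (fun i => blockAvg (P := F.P K) (j := i) (expMeanLogSU (n := Fin 2))) j U₀) (Averaging.iter (fun i => blockAvg (P := F.P K) (j := i) (expMeanLogSU (n := Fin 2))) j W)) b‖ ≤ μ j)
    (hμ72 : ∀ j < K - n, 72 * μ j ≤ 1) (hμN : ∀ j < K - n, 3 * μ j + 1 / 24 < deltaSU (Fin 2)) :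
    ((1 / 2) * (((F.L : ℝ) ^ (K - n)) ^ 2)⁻¹ - (18 + 76800 * (F.L : ℝ) ^ 4) * δ) * (∑ b : PBond (F.P K) 0, ‖pertVar U₀ W b‖ ^ 2) - (18 + 76800 * (F.L : ℝ) ^ 4) * Z
        - 96 * ((F.L : ℝ) ^ (K - n))⁻¹ * (Real.exp ((159 * ((((F.P K).d + 2) * (F.P K).L : ℕ) : ℝ) * Real.sqrt (2 * (F.P K).d * (((F.P K).L : ℝ)) ^ (F.P K).d * (2 * (F.P K).d))) / Real.sqrt (((((F.P K).L : ℝ)) ^ (F.P K).d)⁻¹ * (((F.P K).L : ℝ)) ^ 2) * ∑ i ∈ Finset.range (K - n), (((((F.P K).d + 2) * (F.P K).L : ℕ) : ℝ) ^ 2 / 2 * (2 * ε) * ((((F.P K).L : ℝ)) ^ (2 * i) / (((F.P K).L : ℝ)) ^ (2 * (K - n))))) * (∑ i ∈ Finset.range (K - n), Real.sqrt (((((F.P K).L : ℝ)) ^ (F.P K).d)⁻¹ * (((F.P K).L : ℝ)) ^ 2) ^ ((K - n) - 1 - i) * (260 * (μ i * (((((F.P K).d + 2) * (F.P K).L : ℕ)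 : ℝ) * Real.sqrt (2 * (F.P K).d * (((F.P K).L : ℝ)) ^ (F.P K).d * (2 * (F.P K).d)) * Real.sqrt (∑ b : PBond (F.P K) i, ‖(pertVar (Averaging.iter (fun i => blockAvg (P := F.P K) (j := i) (expMeanLogSU (n := Fin 2))) i U₀) (Averaging.iter (fun i => blockAvg (P := F.P K) (j := i) (expMeanLogSU (n := Fin 2))) i W)) b‖ ^ 2)))))
        + 2 * Real.sqrt (F.P K).d * ∑ j ∈ Finset.range (K - n), Real.sqrt (4 * (F.P K).d * ((((F.P K).d : ℝ) + 2) ^ 2 * (2 : ℕ) * (((F.P K).L : ℝ)) ^ 4) + (4 * (((F.P K).d : ℝ) + 2) ^ 2 * ((F.P K).d : ℝ) ^ 3 * (3 * (2 : ℕ) + 2 * (F.P K).d) * (((F.P K).L : ℝ)) ^ 6) * (2 * (2 * ε)) ^ 2) * (Real.exp ((159 * ((((F.P K).d + 2) * (F.P K).L : ℕ) : ℝ) * Real.sqrt (2 * (F.P K).d * (((F.P K).L : ℝ)) ^ (F.P K).d * (2 * (F.P K).d))) / Real.sqrt (((((F.P K).L : ℝ)) ^ (F.P K).d)⁻¹ *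 (((F.P K).L : ℝ)) ^ 2) * ∑ i ∈ Finset.range j, (((((F.P K).d + 2) * (F.P K).L : ℕ) : ℝ) ^ 2 / 2 * (2 * ε) * ((((F.P K).L : ℝ)) ^ (2 * i) / (((F.P K).L : ℝ)) ^ (2 * (K - n))))) * (∑ i ∈ Finset.range j, Real.sqrt (((((F.P K).L : ℝ)) ^ (F.P K).d)⁻¹ * (((F.P K).L : ℝ)) ^ 2) ^ (j - 1 - i) * (260 * (μ i * (((((F.P K).d + 2) * (F.P K).L : ℕ) : ℝ) * Real.sqrt (2 * (F.P K).d * (((F.P K).L : ℝ)) ^ (F.P K).d * (2 * (F.P K).d)) * Real.sqrt (∑ b : PBond (F.P K) i, ‖(pertVar (Averaging.iter (fun i => blockAvg (P := F.P K) (j := i) (expMeanLogSU (n := Fin 2))) i U₀) (Averaging.iter (fun i => blockAvg (P := F.P K) (j := i) (expMeanLogSU (n := Fin 2))) i W)) b‖ ^ 2))))))) ^ 2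
      ≤ (18 + 76800 * (F.L : ℝ) ^ 4) * (∑ x : Site (F.P K) 0, ∑ μ : Fin (F.P K).d, ∑ ν : Fin (F.P K).d,
            (if μ < ν then ∑ j : Fin 2, ∑ k : Fin 2,
              ‖(curl (torusT (F.P K) 0) (fun κ z => unitsField (toUField U₀) ⟨z, κ⟩) (fun κ z => pertVar U₀ W ⟨z, κ⟩) μ ν x) j k‖ ^ 2 else 0)) := by
  have hL3 := three_le_L F
  have hLpos : (0 : ℝ) < (F.L : ℝ) := by linarith
  have hLF : (F.P K).L = F.L := rfl
  have hk : K - n ≤ (F.P K).m + (F.P K).K := by show K - n ≤ F.m + K; omega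
  -- numerals: the knit's `10⁶L⁵ε ≤ 1`, hence the tower numerals at `2ε`
  have hL1 : (1 : ℝ) ≤ (F.L : ℝ) := by linarith
  have hεL6 : 1000000 * (F.L : ℝ) ^ 5 * ε ≤ 1 := by
    have h1 : (F.L : ℝ) ^ 5 ≤ (F.L : ℝ) ^ 9 := pow_le_pow_right₀ hL1 (by norm_num)
    nlinarith [h1, hε.le]
  obtain ⟨-, hε3, hε2, hε24, -⟩ := smallness_T3 F K hε hεL6
  have hε' : 0 < 2 * ε := by linarith only [hε]
  have hU' : PlaqSmall (2 * ε * ((((F.P K).L : ℝ) ^ (K - n))⁻¹) ^ 2) U₀ := by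
    refine plaqSmall_of_le_of_lt hU ?_
    rw [hLF, inv_pow]
    exact mul_lt_mul_of_pos_right (by linarith only [hε]) (inv_pos.mpr (by positivity))
  -- the junction's tower sizes
  have hα := loop_size_geom (N := 2) (K - n) hε' hε3 hε2 hU'
  obtain ⟨hale, h24, hN⟩ := size_numerals (N := 2) (K - n) hε' hε2 hε24
  have ha0 : ∀ j : ℕ, (0 : ℝ) ≤ (((((F.P K).d + 2) * (F.P K).L : ℕ) : ℝ) ^ 2 / 2 * (2 * ε) * ((((F.P K).L : ℝ)) ^ (2 * j) / (((F.P K).L : ℝ)) ^ (2 * (K - n)))) := fun j => by positivity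
  have hV : ∀ j < K - n, ∀ q : Plaq (F.P K) j,
      dist1 (GaugeField.plaqHol (Averaging.iter (fun i => blockAvg (P := F.P K) (j := i) (expMeanLogSU (n := Fin 2))) j U₀) q) ≤ 2 * (2 * ε) :=
    fun j hj q => ((tower_plaq_lt (K - n) hε' hε3 hε2 hU' hj.le q).2).le
  -- the `Q`-junction in sup × mass form
  have hJ := sqrt_sum_normSq_trueLinIter_le_of_iter_eq_mass U₀ W hk hfib Q hQ0 hQs (fun j => (((((F.P K).d + 2) * (F.P K).L : ℕ) : ℝ) ^ 2 / 2 * (2 * ε) * ((((F.P K).L : ℝ)) ^ (2 * j) / (((F.P K).L : ℝ)) ^ (2 * (K - n))))) ha0 (by positivity) hα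
    (fun j hj => (hale j hj).trans h24) (fun j hj => (hale j hj).trans_lt hN) hV μ hμ0 hμ hμ72
    (fun j hj => by linarith only [hμN j hj, (hale j hj).trans h24])
  have hQ : ∑ c : PBond (F.P K) (K - n), ‖Q (K - n) (pertVar U₀ W) c‖ ^ 2 ≤ (Real.exp ((159 * ((((F.P K).d + 2) * (F.P K).L : ℕ) : ℝ) * Real.sqrt (2 * (F.P K).d * (((F.P K).L : ℝ)) ^ (F.P K).d * (2 * (F.P K).d))) / Real.sqrt (((((F.P K).L : ℝ)) ^ (F.P K).d)⁻¹ * (((F.P K).L : ℝ)) ^ 2) * ∑ i ∈ Finset.range (K - n), (((((F.P K).d + 2) * (F.P K).L : ℕ) : ℝ) ^ 2 / 2 * (2 * ε) * ((((F.P K).L : ℝ)) ^ (2 * i) / (((F.P K).L : ℝ)) ^ (2 * (K - n))))) * (∑ i ∈ Finset.range (K - n), Real.sqrt (((((F.P K).L : ℝ)) ^ (F.P K).d)⁻¹ * (((F.P K).L : ℝ)) ^ 2) ^ ((K - n) - 1 - i) * (260 * (μ i * (((((F.P K).d + 2) * (F.P K).L : ℕ) : ℝ) * Real.sqrt (2 *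 (F.P K).d * (((F.P K).L : ℝ)) ^ (F.P K).d * (2 * (F.P K).d)) * Real.sqrt (∑ b : PBond (F.P K) i, ‖(pertVar (Averaging.iter (fun i => blockAvg (P := F.P K) (j := i) (expMeanLogSU (n := Fin 2))) i U₀) (Averaging.iter (fun i => blockAvg (P := F.P K) (j := i) (expMeanLogSU (n := Fin 2))) i W)) b‖ ^ 2)))))
        + 2 * Real.sqrt (F.P K).d * ∑ j ∈ Finset.range (K - n), Real.sqrt (4 * (F.P K).d * ((((F.P K).d : ℝ) + 2) ^ 2 * (2 : ℕ) * (((F.P K).L : ℝ)) ^ 4) + (4 * (((F.P K).d : ℝ) + 2) ^ 2 * ((F.P K).d : ℝ) ^ 3 * (3 * (2 : ℕ) + 2 * (F.P K).d) * (((F.P K).L : ℝ)) ^ 6) * (2 * (2 * ε)) ^ 2) * (Real.exp ((159 * ((((F.P K).d + 2) * (F.P K).L : ℕ) : ℝ) * Real.sqrt (2 * (F.P K).d * (((F.P K).L : ℝ)) ^ (F.P K).d * (2 * (F.P K).d))) / Real.sqrt (((((F.P K).L : ℝ)) ^ (F.P K).d)⁻¹ * (((F.P K).L : ℝ)) ^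 2) * ∑ i ∈ Finset.range j, (((((F.P K).d + 2) * (F.P K).L : ℕ) : ℝ) ^ 2 / 2 * (2 * ε) * ((((F.P K).L : ℝ)) ^ (2 * i) / (((F.P K).L : ℝ)) ^ (2 * (K - n))))) * (∑ i ∈ Finset.range j, Real.sqrt (((((F.P K).L : ℝ)) ^ (F.P K).d)⁻¹ * (((F.P K).L : ℝ)) ^ 2) ^ (j - 1 - i) * (260 * (μ i * (((((F.P K).d + 2) * (F.P K).L : ℕ) : ℝ) * Real.sqrt (2 * (F.P K).d * (((F.P K).L : ℝ)) ^ (F.P K).d * (2 * (F.P K).d)) * Real.sqrt (∑ b : PBond (F.P K) i, ‖(pertVar (Averaging.iter (fun i => blockAvg (P := F.P K) (j := i) (expMeanLogSU (n := Fin 2))) i U₀) (Averaging.iter (fun i => blockAvg (P := F.P K) (j := i) (expMeanLogSU (n := Fin 2))) i W)) b‖ ^ 2))))))) ^ 2 := by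
    have h0 : 0 ≤ ∑ c : PBond (F.P K) (K - n), ‖Q (K - n) (pertVar U₀ W) c‖ ^ 2 := Finset.sum_nonneg fun _ _ => sq_nonneg _
    have h1 := pow_le_pow_left₀ (Real.sqrt_nonneg _) hJ 2
    rwa [Real.sq_sqrt h0] at h1
  exact sum_normSq_le_curl_sq_core_of_hLambdaCurl_T3 F n K U₀ hε hεL hU Q hQ0 hQs (pertVar U₀ W) G S Λ hG0 hS0 hΛ0 hΛs hGs hSs hdivB hQ hΛcurl

end Summit.QuantumFields.YangMills.Theorems.Prop7CurvedLandauCoreFibreT3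

end
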